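import Summits.CriticalPhenomena.PercolationContinuityZ3.Theorems.PercNearOneGluingNoHeavyLowerTailSahiC3CubeThreeFKG

/-!
# `NoHeavyLowerTail` (crux stmt-CriticalPhenomena-4575), Sahi programme P1: from indicators to monotone FUNCTIONS — Sahi's `E₃ ≥ 0`
# for three nonnegative monotone functions on `{0,1}³` under every FKG measure

Support file (Sahi cell, seat `prim-sahi-p1`; `--supports stmt-CriticalPhenomena-4575`).  Sahi's Conjecture 5 [Combinatorica 28 (2008)]
is stated for positive monotone FUNCTIONS; `…SahiC3CubeThreeFKG` proves the indicator case on `{0,1}³` for every log-supermodular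
weight.  Here the standard finite layer-cake argument (trilinearity of `E₃`; a nonnegative monotone function on a finite poset is a
nonnegative combination of indicators of up-sets) upgrades it:

* `sum_mul_nonneg_of_upperSet` — on a finite preorder, a weight `w` with `Σ_{x∈U} w x ≥ 0` for every up-set `U` satisfies
  `Σ_x w x · f x ≥ 0` for every monotone `f ≥ 0` (induction on the support: peel off `(min f) · 1_{supp f}`);
* `latticeE3fun μ f g h := 2Z²·Σμfgh + (Σμf)(Σμg)(Σμh) − Z·Σ_cyc (Σμf)(Σμgh)` (`= Z³·E₃(f,g,h)` for the normalised measure),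
  `latticeE3fun_indicator` (agrees with `latticeE3` on indicators), linearity in the first slot and symmetry;
* `latticeE3fun_nonneg_of_indicator` — on any finite type: `E₃ ≥ 0` on all up-set triples ⇒ `E₃ ≥ 0` on all monotone nonnegative
  triples;
* **`latticeE3fun_nonneg_cube_three`** — Sahi's Conjecture 5 at `n = 3` on `{0,1}³`, verbatim (three nonnegative monotone functions,
  any nonnegative log-supermodular weight).
-/

namespace Summit.CriticalPhenomena.PercolationContinuityZ3.Theorems.SahiC3Cube

open Finset Literature.Probability.LatticeModels
open scoped BigOperators

section LayerCake

variable {α : Type*} [Fintype α] [Preorder α]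

/-- **Finite layer cake.**  If `Σ_{x∈U} w x ≥ 0` for every up-set `U`, then `Σ_x w x · f x ≥ 0` for every monotone `f ≥ 0`.
[folklore] -/
theorem sum_mul_nonneg_of_upperSet [DecidableEq α] (w : α → ℝ)
    (hw : ∀ U : Finset α, IsUpperSet (U : Set α) → 0 ≤ ∑ x ∈ U, w x) :
    ∀ (f : α → ℝ), Monotone f → (∀ x, 0 ≤ f x) → 0 ≤ ∑ x, w x * f x := by
  -- induction on the size of the support
  suffices h : ∀ (n : ℕ) (f : α → ℝ), (univ.filter fun x => f x ≠ 0).card ≤ n → Monotone f → (∀ x, 0 ≤ f x) →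
      0 ≤ ∑ x, w x * f x from fun f hf h0 => h _ f le_rfl hf h0
  intro n
  induction n with
  | zero =>
    intro f hcard _ _
    have hz : ∀ x, f x = 0 := fun x => by
      by_contra hx
      have : x ∈ univ.filter fun x => f x ≠ 0 := by simp [hx]
      rw [Nat.le_zero, Finset.card_eq_zero] at hcard
      rw [hcard] at this; simp at this
    simp [hz]
  | succ n ih =>
    intro f hcard hf h0
    by_cases hne : (univ.filter fun x => f x ≠ 0).Nonempty
    · -- peel off `t · 1_U`, `U = supp f`, `t = min_U f`
      set U : Finset α := univ.filter fun x => f x ≠ 0 with hU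
      obtain ⟨x₀, hx₀U, hmin⟩ := U.exists_min_image f hne
      set t := f x₀ with ht
      have hx₀ : f x₀ ≠ 0 := by simpa [hU] using hx₀U
      have htpos : 0 < t := lt_of_le_of_ne (h0 x₀) (Ne.symm hx₀)
      have hUup : IsUpperSet (U : Set α) := by
        intro x y hxy hx
        simp only [hU, Finset.coe_filter, Finset.mem_univ, true_and, Set.mem_setOf_eq] at hx ⊢
        intro hy
        exact hx (le_antisymm (by rw [← hy]; exact hf hxy) (h0 x))
      -- the peeled function
      let f' : α → ℝ := fun x => if f x ≠ 0 then f x - t else 0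
      have hf't : ∀ x, f x = f' x + t * (if x ∈ U then 1 else 0) := by
        intro x
        by_cases hx : f x ≠ 0
        · have : x ∈ U := by simp [hU, hx]
          simp [f', hx, this]
        · have hx' : f x = 0 := not_not.1 hx
          have : x ∉ U := by simp [hU, hx']
          simp [f', hx', this]
      have hf'0 : ∀ x, 0 ≤ f' x := by
        intro x
        by_cases hx : f x ≠ 0
        · have : t ≤ f x := hmin x (by simp [hU, hx])
          simp [f', hx]; linarith
        · have hx' : f x = 0 := not_not.1 hx
          simp [f', hx']
      have hf'mono : Monotone f' := by
        intro x y hxy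
        by_cases hx : f x ≠ 0
        · have hy : f y ≠ 0 := fun hy => hx (le_antisymm (by rw [← hy]; exact hf hxy) (h0 x))
          simp only [f', hx, hy, ne_eq, not_false_eq_true, if_true]
          linarith [hf hxy]
        · have hx' : f x = 0 := not_not.1 hx
          have : f' x = 0 := by simp [f', hx']
          rw [this]; exact hf'0 y
      have hcard' : (univ.filter fun x => f' x ≠ 0).card ≤ n := by
        have hsub : (univ.filter fun x => f' x ≠ 0) ⊆ U.erase x₀ := by
          intro x hx
          simp only [Finset.mem_filter, Finset.mem_univ, true_and] at hx
          rw [Finset.mem_erase]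
          refine ⟨fun hxx => ?_, ?_⟩
          · subst hxx; simp [f', hx₀, ht] at hx
          · by_contra hxU
            have : f x = 0 := by simpa [hU] using hxU
            simp [f', this] at hx
        have := Finset.card_le_card hsub
        rw [Finset.card_erase_of_mem hx₀U] at this
        omega
      have key : ∑ x, w x * f x = ∑ x, w x * f' x + t * ∑ x ∈ U, w x := by
        have hpt : ∀ x, w x * f x = w x * f' x + (if x ∈ U then t * w x else 0) := by
          intro x; rw [hf't x]; split_ifs <;> ring
        rw [Finset.sum_congr rfl (fun x _ => hpt x), Finset.sum_add_distrib, Finset.sum_ite_mem, Finset.univ_inter,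
          Finset.mul_sum]
      rw [key]
      exact add_nonneg (ih f' hcard' hf'mono hf'0) (mul_nonneg htpos.le (hw U hUup))
    · rw [Finset.not_nonempty_iff_eq_empty] at hne
      have hz : ∀ x, f x = 0 := fun x => by
        by_contra hx
        have : x ∈ univ.filter fun x => f x ≠ 0 := by simp [hx]
        rw [hne] at this; simp at this
      simp [hz]

end LayerCake

/-! ## The functional `E₃` on nonnegative monotone functions -/

section Fun

variable {α : Type*} [Fintype α]

/-- Sahi's third functional for three FUNCTIONS under a weight, homogeneous form (`= Z³·E₃(f,g,h)` for the normalised measure):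
`2Z²·Σμfgh + (Σμf)(Σμg)(Σμh) − Z·((Σμf)(Σμgh) + (Σμg)(Σμfh) + (Σμh)(Σμfg))`. [cite: LiebSahi2021, eq. (2.1) (arXiv p. 5)] -/
def latticeE3fun (μ : α → ℝ) (f g h : α → ℝ) : ℝ :=
  2 * (∑ x, μ x) ^ 2 * (∑ x, μ x * (f x * g x * h x)) + (∑ x, μ x * f x) * (∑ x, μ x * g x) * (∑ x, μ x * h x) -
    (∑ x, μ x) * ((∑ x, μ x * f x) * (∑ x, μ x * (g x * h x)) + (∑ x, μ x * g x) * (∑ x, μ x * (f x * h x)) +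
      (∑ x, μ x * h x) * (∑ x, μ x * (f x * g x)))

/-- The weight of the first slot: `latticeE3fun μ f g h = Σ_x (μ x · ℓ x) · f x`. [this work] -/
def slotWeight (μ : α → ℝ) (g h : α → ℝ) (x : α) : ℝ :=
  μ x * (2 * (∑ y, μ y) ^ 2 * (g x * h x) + (∑ y, μ y * g y) * (∑ y, μ y * h y) -
    (∑ y, μ y) * ((∑ y, μ y * (g y * h y)) + (∑ y, μ y * g y) * h x + (∑ y, μ y * h y) * g x))

/-- Linearity of `latticeE3fun` in its first slot. [this work] -/
theorem latticeE3fun_eq_sum_slotWeight (μ : α → ℝ) (f g h : α → ℝ) :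
    latticeE3fun μ f g h = ∑ x, slotWeight μ g h x * f x := by
  have hpt : ∀ x, slotWeight μ g h x * f x =
      2 * (∑ y, μ y) ^ 2 * (μ x * (f x * g x * h x)) + (∑ y, μ y * g y) * (∑ y, μ y * h y) * (μ x * f x) -
        (∑ y, μ y) * (∑ y, μ y * (g y * h y)) * (μ x * f x) - (∑ y, μ y) * (∑ y, μ y * g y) * (μ x * (f x * h x)) -
          (∑ y, μ y) * (∑ y, μ y * h y) * (μ x * (f x * g x)) := by
    intro x; unfold slotWeight; ring
  rw [Finset.sum_congr rfl (fun x _ => hpt x), Finset.sum_sub_distrib, Finset.sum_sub_distrib, Finset.sum_sub_distrib,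
    Finset.sum_add_distrib, ← Finset.mul_sum, ← Finset.mul_sum, ← Finset.mul_sum, ← Finset.mul_sum, ← Finset.mul_sum]
  unfold latticeE3fun
  ring

/-- `latticeE3fun` is symmetric in its first two slots. [folklore] -/
theorem latticeE3fun_comm₁₂ (μ : α → ℝ) (f g h : α → ℝ) : latticeE3fun μ f g h = latticeE3fun μ g f h := by
  unfold latticeE3fun
  have e1 : ∑ x, μ x * (f x * g x * h x) = ∑ x, μ x * (g x * f x * h x) := Finset.sum_congr rfl fun x _ => by ring
  have e2 : ∑ x, μ x * (f x * g x) = ∑ x, μ x * (g x * f x) := Finset.sum_congr rfl fun x _ => by ring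
  rw [e1, e2]; ring

/-- `latticeE3fun` is symmetric in its last two slots. [folklore] -/
theorem latticeE3fun_comm₂₃ (μ : α → ℝ) (f g h : α → ℝ) : latticeE3fun μ f g h = latticeE3fun μ f h g := by
  unfold latticeE3fun
  have e1 : ∑ x, μ x * (f x * g x * h x) = ∑ x, μ x * (f x * h x * g x) := Finset.sum_congr rfl fun x _ => by ring
  have e2 : ∑ x, μ x * (g x * h x) = ∑ x, μ x * (h x * g x) := Finset.sum_congr rfl fun x _ => by ring
  rw [e1, e2]; ring

/-- The indicator of a finite set as a real function. [folklore] -/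
def ind [DecidableEq α] (A : Finset α) : α → ℝ := fun x => if x ∈ A then 1 else 0

/-- On indicators `latticeE3fun` is `latticeE3`. [this work] -/
theorem latticeE3fun_indicator [DecidableEq α] (μ : α → ℝ) (A B C : Finset α) :
    latticeE3fun μ (ind A) (ind B) (ind C) = latticeE3 μ A B C := by
  have m1 : ∀ S : Finset α, ∑ x, μ x * ind S x = mass μ S := fun S => sum_mul_indicator_eq_mass μ S
  have m2 : ∀ S T : Finset α, ∑ x, μ x * (ind S x * ind T x) = mass μ (S ∩ T) := fun S T =>
    sum_mul_indicator_mul_indicator_eq_mass μ S T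
  have m3 : ∑ x, μ x * (ind A x * ind B x * ind C x) = mass μ (A ∩ B ∩ C) := by
    have : ∀ x, ind A x * ind B x * ind C x = ind (A ∩ B) x * ind C x := by
      intro x; unfold ind; by_cases hA : x ∈ A <;> by_cases hB : x ∈ B <;> simp [hA, hB]
    simp_rw [this]; exact m2 (A ∩ B) C
  unfold latticeE3fun latticeE3
  rw [m3, m1, m1, m1, m2, m2, m2, ← mass_univ]

/-- **Indicators to functions.**  If `latticeE3 μ A B C ≥ 0` for all up-sets `A, B, C` of a finite preorder, then
`latticeE3fun μ f g h ≥ 0` for all monotone nonnegative `f, g, h`. [this work] -/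
theorem latticeE3fun_nonneg_of_indicator [Preorder α] [DecidableEq α] {μ : α → ℝ}
    (hind : ∀ A B C : Finset α, IsUpperSet (A : Set α) → IsUpperSet (B : Set α) → IsUpperSet (C : Set α) →
      0 ≤ latticeE3 μ A B C)
    {f g h : α → ℝ} (hf : Monotone f) (hg : Monotone g) (hh : Monotone h) (hf0 : ∀ x, 0 ≤ f x) (hg0 : ∀ x, 0 ≤ g x)
    (hh0 : ∀ x, 0 ≤ h x) : 0 ≤ latticeE3fun μ f g h := by
  -- slot 1: indicators B, C, any monotone f
  have step1 : ∀ (B C : Finset α), IsUpperSet (B : Set α) → IsUpperSet (C : Set α) →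
      ∀ f : α → ℝ, Monotone f → (∀ x, 0 ≤ f x) → 0 ≤ latticeE3fun μ f (ind B) (ind C) := by
    intro B C hB hC f hf hf0
    rw [latticeE3fun_eq_sum_slotWeight]
    refine sum_mul_nonneg_of_upperSet _ (fun U hU => ?_) f hf hf0
    have := hind U B C hU hB hC
    rw [← latticeE3fun_indicator, latticeE3fun_eq_sum_slotWeight] at this
    have e : ∑ x, slotWeight μ (ind B) (ind C) x * ind U x = ∑ x ∈ U, slotWeight μ (ind B) (ind C) x := by
      unfold ind; simp only [mul_ite, mul_one, mul_zero]; rw [Finset.sum_ite_mem, Finset.univ_inter]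
    rwa [e] at this
  -- slot 2: monotone f, indicator C, any monotone g
  have step2 : ∀ (C : Finset α), IsUpperSet (C : Set α) → ∀ g : α → ℝ, Monotone g → (∀ x, 0 ≤ g x) →
      0 ≤ latticeE3fun μ f g (ind C) := by
    intro C hC g hg hg0
    rw [latticeE3fun_comm₁₂, latticeE3fun_eq_sum_slotWeight]
    refine sum_mul_nonneg_of_upperSet _ (fun U hU => ?_) g hg hg0
    have := step1 U C hU hC f hf hf0
    rw [latticeE3fun_comm₁₂, latticeE3fun_eq_sum_slotWeight] at this
    have e : ∑ x, slotWeight μ f (ind C) x * ind U x = ∑ x ∈ U, slotWeight μ f (ind C) x := by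
      unfold ind; simp only [mul_ite, mul_one, mul_zero]; rw [Finset.sum_ite_mem, Finset.univ_inter]
    rwa [e] at this
  -- slot 3
  rw [latticeE3fun_comm₂₃, latticeE3fun_comm₁₂, latticeE3fun_eq_sum_slotWeight]
  refine sum_mul_nonneg_of_upperSet _ (fun U hU => ?_) h hh hh0
  have := step2 U hU g hg hg0
  rw [latticeE3fun_comm₂₃, latticeE3fun_comm₁₂, latticeE3fun_eq_sum_slotWeight] at this
  have e : ∑ x, slotWeight μ f g x * ind U x = ∑ x ∈ U, slotWeight μ f g x := by
    unfold ind; simp only [mul_ite, mul_one, mul_zero]; rw [Finset.sum_ite_mem, Finset.univ_inter]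
  rwa [e] at this

end Fun

/-- **Sahi's Conjecture 5 at `n = 3` on `{0,1}³`, verbatim**: for every nonnegative log-supermodular weight `μ` on the cube
`Fin 3 → Bool` and all monotone nonnegative `f, g, h`,
`0 ≤ 2Z²·Σμfgh + (Σμf)(Σμg)(Σμh) − Z·((Σμf)(Σμgh) + (Σμg)(Σμfh) + (Σμh)(Σμfg))` (`= Z³·E₃(f,g,h)`). [this work] -/
theorem latticeE3fun_nonneg_cube_three {μ : (Fin 3 → Bool) → ℝ} (hμ₀ : 0 ≤ μ)
    (hμ : ∀ a b, μ a * μ b ≤ μ (a ⊓ b) * μ (a ⊔ b)) {f g h : (Fin 3 → Bool) → ℝ} (hf : Monotone f) (hg : Monotone g)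
    (hh : Monotone h) (hf0 : ∀ x, 0 ≤ f x) (hg0 : ∀ x, 0 ≤ g x) (hh0 : ∀ x, 0 ≤ h x) : 0 ≤ latticeE3fun μ f g h :=
  latticeE3fun_nonneg_of_indicator (fun _ _ _ hA hB hC => latticeE3_nonneg_cube_three hμ₀ hμ hA hB hC) hf hg hh hf0 hg0 hh0

end Summit.CriticalPhenomena.PercolationContinuityZ3.Theorems.SahiC3Cube
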